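import Summits.FinalStateConjecture.FinalStateConjecture.Theorems.PhotonSphereChannelsTameHullDefs
import Literature.Geometry.Lorentzian.FlatQuietCollarExclusion
import Literature.Geometry.Lorentzian.KerrFramedCompactness
import Literature.Geometry.Lorentzian.KerrCurvatureInvariants
import Literature.Geometry.Lorentzian.SpacetimeKretschmannScalar
import HarnessLib

/-!
# Route PhotonSphereChannels · crux `ChannelsResolveTameDevelopmentsR` (K2R-T2, stmt-FinalStateConjecture-17430) —
# pointwise `C²`-rigidity of Kerr against flat charts: no chart of a Kerr region into Minkowski space has
# small `2`-jets of the deviation at an equatorial point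

The bridge stub B of the surviving line `dark-future-exactness` (`Cruxes/…/Lines/dark_future_exactness.lean`,
`IsSlabClose 𝓢 E M a k β c δ`) and every other near-Kerr hypothesis of the crux tree measure a spacetime
against the Kerr–Schild components `g_{M,a}` on a horizon-penetrating region `Kerr.region a r₁` through
the jets of `Spacetime.deviationExtend ⟨Kerr.region a r₁, g_{M,a}, t*, r⟩ Ψ = Ψ^* g − g_{M,a}`. The flat end
(`…RFlatTameEnd`, on which B's conclusion fails) must therefore NOT be close in these norms. This file
proves the pointwise, chart-free reason, for the host Minkowski space:

**`exists_jet_gt_of_flatChart`.** For `M > 0`, every `a`, `r₁`, and every EQUATORIAL point `x₀` of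
`Kerr.region a r₁` (`x₀³ = 0`) there is `δ₀ > 0` such that for EVERY map `Ψ` of the region into Minkowski
spacetime, smooth on an open set `L ∋ x₀`, one of the jets `‖D^m(Ψ^*η − g_{M,a})(x₀)‖`, `m ≤ 2`, exceeds
`δ₀`. Proof (the Kretschmann exclusion of `FlatQuietCollarExclusion`, at ONE point and fixed parameters, so
no window compactness): if all three jets were `≤ δ`, the flat chart metric `Φ^*η` (`KerrWindow.chartForm`,
curvature `0` where nondegenerate, `riemAt_chartForm_eq_zero`) would be a metric component field near `x₀`
with `2`-jet `δ`-close to that of `g_{M,a}` (`jets_deviationExtend`), forcing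
`|Rm|²_{g_{M,a}}(x₀) ≤ C(N)·δ²` (`IsMetricOn.abs_rmNormSqAt_le_of_flat_close`) — but it equals
`48M²/r⁶ > 0` (`Kerr.kretschmannScalar_closedForm_holds`). Corollary `not_forall_jets_le_of_flatChart`:
the weighted form used by `IsSlabClose` (`‖D^m dev(x₀)‖ · r^{β+m} ≤ δ` for `m ≤ k`, any `k ≥ 2`, any
real `β`) fails at `x₀` for `δ < δ₀ · min_m r(x₀)^{β+m}` — the flat end is not slab-close to Kerr of
positive mass at order `≥ 2`.

All results proved; no definitions.

## References

* B. Kotschwar, Comm. Anal. Geom. 22 (2014), §1.1 (8). [Kotschwar2014]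
* B. O'Neill, *Semi-Riemannian geometry* (1983), Ch. 3, Prop. 3.41, Prop. 3.59. [ONeill1983]
* M. Visser, arXiv:0706.0622, §3. [arXiv07060622]
-/

noncomputable section

set_option maxSynthPendingDepth 3
set_option linter.dupNamespace false

open Set Filter Function TopologicalSpace Metric
open scoped Topology Manifold ContDiff ENNReal NNReal

namespace Summit.FinalStateConjecture.FinalStateConjecture.Theorems.HullCurvature

open Literature.Geometry.Lorentzian
open Literature.Geometry.Lorentzian.MetricCoord
open Literature.Geometry.Lorentzian.KerrWindow

/-- **Pointwise `C²`-rigidity of Kerr against flat charts.** For `M > 0` and an equatorial point `x₀` of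
`Kerr.region a r₁` there is `δ₀ > 0` such that every map `Ψ : Kerr.region a r₁ → ℝ⁴₁`, smooth on an open
`L ∋ x₀`, has SOME deviation jet `‖D^m(Ψ^*η − g_{M,a})(x₀)‖ > δ₀`, `m ≤ 2`. [cite: Kotschwar2014, §1.1 (8)] -/
theorem exists_jet_gt_of_flatChart : ∀ (M a r₁ : ℝ), 0 < M → ∀ x₀ : Kerr.region a r₁, (x₀ : E4) 3 = 0 → ∃ δ₀ : ℝ, 0 < δ₀ ∧ ∀ (Ψ : (Kerr.regionBackground M a r₁).domain → Minkowski.spacetime.carrier) (L : Set (Kerr.regionBackground M a r₁).domain), IsOpen L → x₀ ∈ L → ContMDiffOn 𝓘(ℝ, E4) (𝓡 4) ∞ Ψ L → ∃ m ≤ 2, δ₀ < ‖iteratedFDeriv ℝ m (Minkowski.spacetime.deviationExtend (Kerr.regionBackground M a r₁) Ψ) x₀‖ := by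
  intro M a r₁ hM x₀ hx3
  -- canonical shortcut instances on the space of bilinear forms (as in `FlatQuietCollarExclusion`)
  letI : NormedAddCommGroup (E4 →L[ℝ] E4 →L[ℝ] ℝ) := ContinuousLinearMap.toNormedAddCommGroup
  letI : NormedSpace ℝ (E4 →L[ℝ] E4 →L[ℝ] ℝ) := ContinuousLinearMap.toNormedSpace
  -- the Kerr components, metric on the region, their jets at `x₀`
  have hGm : IsMetricOn (Kerr.bilin M a) (Kerr.region a r₁ : Set E4) := KerrSchildChart.isMetricOn_kerrBilin M a r₁
  have hx₀ : (x₀ : E4) ∈ (Kerr.region a r₁ : Set E4) := x₀.2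
  have hr : 0 < Kerr.radius a x₀ := Kerr.radius_pos_of_mem_region hx₀
  have hK : rmNormSqAt (Kerr.bilin M a) x₀ = 48 * M ^ 2 / Kerr.radius a x₀ ^ 6 :=
    Kerr.kretschmannScalar_equatorial Kerr.kretschmannScalar_closedForm_holds M a hr hx3
  have hKpos : 0 < rmNormSqAt (Kerr.bilin M a) x₀ :=
    Kerr.kretschmannScalar_equatorial_pos Kerr.kretschmannScalar_closedForm_holds hM.ne' a hr hx3
  -- uniform invertibility near `g(x₀)` and one constant for all jets
  obtain ⟨δ₁, hδ₁, C, hC⟩ := exists_uniform_inverse_bound (K := {Kerr.bilin M a x₀}) isCompact_singleton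
    (by simpa using hGm.isInvertible _ hx₀)
  obtain ⟨N, hN1, hCN, hsN, h1N, h2N⟩ : ∃ N : ℝ, 1 ≤ N ∧ C ≤ N ∧ ‖sharpAt (Kerr.bilin M a) x₀‖ ≤ N ∧
      ‖fderiv ℝ (Kerr.bilin M a) x₀‖ + 1 ≤ N ∧ ‖fderiv ℝ (fderiv ℝ (Kerr.bilin M a)) x₀‖ + 1 ≤ N :=
    ⟨max (max (‖sharpAt (Kerr.bilin M a) x₀‖ + 1) (max C 1))
        (max (‖fderiv ℝ (Kerr.bilin M a) x₀‖ + 1) (‖fderiv ℝ (fderiv ℝ (Kerr.bilin M a)) x₀‖ + 1)),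
      le_trans (le_max_right C 1) ((le_max_right _ _).trans (le_max_left _ _)),
      (le_max_left C 1).trans ((le_max_right _ _).trans (le_max_left _ _)),
      by linarith [(le_max_left (‖sharpAt (Kerr.bilin M a) x₀‖ + 1) (max C 1)).trans (le_max_left _
        (max (‖fderiv ℝ (Kerr.bilin M a) x₀‖ + 1) (‖fderiv ℝ (fderiv ℝ (Kerr.bilin M a)) x₀‖ + 1)))],
      (le_max_left _ _).trans (le_max_right _ _), (le_max_right _ _).trans (le_max_right _ _)⟩
  have hN0 : 0 ≤ N := zero_le_one.trans hN1
  -- the bound `|Rm|² ≤ Q δ²` of the flat-close estimate; choose `δ₀` with `Q δ₀² < |Rm|²(x₀)`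
  obtain ⟨Q, hQ0, hQdef⟩ : ∃ Q : ℝ, 0 ≤ Q ∧ Q = (4 : ℝ) ^ 4 * N ^ 2 * (4 * (42 * N ^ 5) ^ 2) :=
    ⟨_, by positivity, rfl⟩
  obtain ⟨δ₀, hδ₀, hδ₀1, hδ₀δ₁, hδ₀Q⟩ : ∃ δ₀ : ℝ, 0 < δ₀ ∧ δ₀ ≤ 1 ∧ δ₀ ≤ δ₁ ∧
      Q * δ₀ ^ 2 < rmNormSqAt (Kerr.bilin M a) x₀ := by
    set K₀ := rmNormSqAt (Kerr.bilin M a) x₀ with hK₀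
    refine ⟨min (min δ₁ 1) (K₀ / (Q + K₀ + 1)), lt_min (lt_min hδ₁ one_pos) (div_pos hKpos (by positivity)),
      (min_le_left _ _).trans (min_le_right _ _), (min_le_left _ _).trans (min_le_left _ _), ?_⟩
    have hd : min (min δ₁ 1) (K₀ / (Q + K₀ + 1)) ≤ K₀ / (Q + K₀ + 1) := min_le_right _ _
    have hd1 : min (min δ₁ 1) (K₀ / (Q + K₀ + 1)) ≤ 1 := (min_le_left _ _).trans (min_le_right _ _)
    have hd0 : 0 ≤ min (min δ₁ 1) (K₀ / (Q + K₀ + 1)) :=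
      (lt_min (lt_min hδ₁ one_pos) (div_pos hKpos (by positivity))).le
    have hlt : K₀ / (Q + K₀ + 1) < 1 := by
      rw [div_lt_one (by positivity)]; linarith
    have hsq : min (min δ₁ 1) (K₀ / (Q + K₀ + 1)) ^ 2 ≤ K₀ / (Q + K₀ + 1) := by
      calc _ = min (min δ₁ 1) (K₀ / (Q + K₀ + 1)) * min (min δ₁ 1) (K₀ / (Q + K₀ + 1)) := sq _
        _ ≤ 1 * (K₀ / (Q + K₀ + 1)) := by gcongr
        _ = _ := one_mul _
    have hQK : Q * (K₀ / (Q + K₀ + 1)) < K₀ := by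
      rw [mul_div_assoc', div_lt_iff₀ (by positivity)]
      nlinarith
    exact (mul_le_mul_of_nonneg_left hsq hQ0).trans_lt hQK
  refine ⟨δ₀, hδ₀, fun Ψ L hL hx₀L hΨ ↦ ?_⟩
  -- suppose all three jets are `≤ δ₀`
  by_contra hall
  push Not at hall
  have hjet : ∀ m ≤ 2, ‖iteratedFDeriv ℝ m
      (Minkowski.spacetime.deviationExtend (Kerr.regionBackground M a r₁) Ψ) x₀‖ ≤ δ₀ := hall
  have hd0' : ‖Minkowski.spacetime.deviationExtend (Kerr.regionBackground M a r₁) Ψ x₀‖ ≤ δ₀ := by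
    have h := hjet 0 (by norm_num); rwa [norm_iteratedFDeriv_zero] at h
  have hd1' : ‖fderiv ℝ (Minkowski.spacetime.deviationExtend (Kerr.regionBackground M a r₁) Ψ) x₀‖ ≤ δ₀ := by
    have h := hjet 1 (by norm_num)
    rwa [← norm_iteratedFDeriv_fderiv (n := 0), norm_iteratedFDeriv_zero] at h
  have hd2' : ‖fderiv ℝ (fderiv ℝ
      (Minkowski.spacetime.deviationExtend (Kerr.regionBackground M a r₁) Ψ)) x₀‖ ≤ δ₀ := by
    have h := hjet 2 le_rfl
    rwa [← norm_iteratedFDeriv_fderiv (n := 1), ← norm_iteratedFDeriv_fderiv (n := 0),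
      norm_iteratedFDeriv_zero] at h
  -- the manifold-smoothness of `Ψ` into Minkowski space is smoothness into `E4`
  have hΨ' : ContMDiffOn 𝓘(ℝ, E4) 𝓘(ℝ, E4) ∞ Ψ L := hΨ
  -- the jets of the deviation are the differences of the jets of `Φ^*η` and `g_{M,a}`
  have hx₀img : (x₀ : E4) ∈ (Subtype.val '' L : Set E4) := mem_image_of_mem _ hx₀L
  have hO : IsOpen (Subtype.val '' L : Set E4) := isOpen_image_val hL
  have hOdom : (Subtype.val '' L : Set E4) ⊆ (Kerr.region a r₁ : Set E4) := by
    rintro _ ⟨z, _, rfl⟩; exact z.2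
  have hBsm : ∀ y ∈ (Subtype.val '' L : Set E4), ContDiffAt ℝ ∞ (Kerr.regionBackground M a r₁).bilin y :=
    fun y hy ↦ Kerr.contDiffAt_bilin M a (Kerr.radius_pos_of_mem_region (hOdom hy))
  obtain ⟨e0, e1, e2⟩ := jets_deviationExtend hΨ' hL hBsm hx₀img
  -- closeness of the jets of `G' = chartForm Ψ` and `G = g_{M,a}` at `x₀`
  have hc0 : ‖chartForm Ψ x₀ - Kerr.bilin M a x₀‖ ≤ δ₀ := by rw [← e0]; exact hd0'
  have hc1 : ‖fderiv ℝ (chartForm Ψ) x₀ - fderiv ℝ (Kerr.bilin M a) x₀‖ ≤ δ₀ := by rw [← e1]; exact hd1'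
  have hc2 : ‖fderiv ℝ (fderiv ℝ (chartForm Ψ)) x₀ - fderiv ℝ (fderiv ℝ (Kerr.bilin M a)) x₀‖ ≤ δ₀ := by
    rw [← e2]; exact hd2'
  -- `Φ^*η(x₀)` invertible with inverse `≤ C`
  have hinv : (chartForm Ψ x₀).IsInvertible ∧ ‖(chartForm Ψ x₀).inverse‖ ≤ C :=
    hC (Kerr.bilin M a x₀) (mem_singleton _) _ (hc0.trans hδ₀δ₁)
  -- the open set of smooth nondegenerate chart points around `x₀`
  have hsmrep : ∀ y ∈ (Subtype.val '' L : Set E4), ContDiffAt ℝ ∞ (rep Ψ) y :=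
    fun y hy ↦ contDiffAt_rep_of_mem hΨ' hL hy
  have hcf : ContinuousOn (chartForm Ψ) (Subtype.val '' L) :=
    fun y hy ↦ (contDiffAt_chartForm (hsmrep y hy)).continuousAt.continuousWithinAt
  have hW : IsOpen ((Subtype.val '' L : Set E4) ∩ chartForm Ψ ⁻¹' {T | T.IsInvertible}) :=
    hcf.isOpen_inter_preimage hO isOpen_setOf_isInvertible
  have hx₀W : (x₀ : E4) ∈ (Subtype.val '' L : Set E4) ∩ chartForm Ψ ⁻¹' {T | T.IsInvertible} :=
    ⟨hx₀img, hinv.1⟩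
  have hG'm : IsMetricOn (chartForm Ψ) ((Subtype.val '' L : Set E4) ∩ chartForm Ψ ⁻¹' {T | T.IsInvertible}) :=
    isMetricOn_chartForm hW (fun y hy ↦ hsmrep y hy.1) fun y hy ↦ hy.2
  have hGmW : IsMetricOn (Kerr.bilin M a) ((Subtype.val '' L : Set E4) ∩ chartForm Ψ ⁻¹' {T | T.IsInvertible}) :=
    KerrSchildChart.isMetricOn_mono hGm hW (inter_subset_left.trans hOdom)
  have hflat : ∀ X Y Z : E4, riemAt (chartForm Ψ) x₀ X Y Z = 0 := fun X Y Z ↦ by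
    rw [riemAt_chartForm_eq_zero hW (fun y hy ↦ hsmrep y hy.1) (fun y hy ↦ hy.2) hx₀W X Y]
    rfl
  -- bounds fed to the flat-close estimate
  have hs : ‖sharpAt (Kerr.bilin M a) x₀‖ ≤ N := hsN
  have hs' : ‖sharpAt (chartForm Ψ) x₀‖ ≤ N := hinv.2.trans hCN
  have h1 : ‖fderiv ℝ (Kerr.bilin M a) x₀‖ ≤ N := by linarith
  have h2 : ‖fderiv ℝ (fderiv ℝ (Kerr.bilin M a)) x₀‖ ≤ N := by linarith
  have h1' : ‖fderiv ℝ (chartForm Ψ) x₀‖ ≤ N := by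
    have := norm_le_norm_add_norm_sub' (fderiv ℝ (chartForm Ψ) x₀) (fderiv ℝ (Kerr.bilin M a) x₀)
    linarith
  have hd0 : ‖Kerr.bilin M a x₀ - chartForm Ψ x₀‖ ≤ δ₀ := by rw [norm_sub_rev]; exact hc0
  have hd1 : ‖fderiv ℝ (Kerr.bilin M a) x₀ - fderiv ℝ (chartForm Ψ) x₀‖ ≤ δ₀ := by
    rw [norm_sub_rev]; exact hc1
  have hd2 : ‖fderiv ℝ (fderiv ℝ (Kerr.bilin M a)) x₀ - fderiv ℝ (fderiv ℝ (chartForm Ψ)) x₀‖ ≤ δ₀ := by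
    rw [norm_sub_rev]; exact hc2
  have key := hGmW.abs_rmNormSqAt_le_of_flat_close (EuclideanSpace.basisFun (Fin 4) ℝ) hG'm hx₀W hN1
    hδ₀.le hs hs' h1 h1' h2 hflat hd0 hd1 hd2
  -- numerics: `|Rm|²(x₀) ≤ Q δ₀² < |Rm|²(x₀)`
  have hcard : (Fintype.card (Fin 4) : ℝ) = 4 := by norm_num
  have hrank : (Module.finrank ℝ E4 : ℝ) = 4 := by
    rw [finrank_euclideanSpace_fin]; norm_num
  rw [hcard, hrank] at key
  have hQ : (4 : ℝ) ^ 4 * N ^ 2 * (4 * (42 * N ^ 5 * δ₀) ^ 2) = Q * δ₀ ^ 2 := by rw [hQdef]; ring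
  rw [hQ, abs_of_pos hKpos] at key
  exact absurd (key.trans_lt hδ₀Q) (lt_irrefl _)

/-- **The weighted slab form fails at an equatorial point.** Under the same data, for every order `k ≥ 2`
and every real weight exponent `β` there is `δ > 0` such that the weighted bounds
`‖D^m(Ψ^*η − g_{M,a})(x₀)‖ · r(x₀)^{β+m} ≤ δ` for all `m ≤ k` (the clause of `IsSlabClose` at `x₀`) cannot
all hold — for ANY map `Ψ` of the region into Minkowski spacetime smooth near `x₀`: the flat end is not
slab-close, at order `≥ 2`, to Kerr of positive mass. [cite: Kotschwar2014, §1.1 (8)] -/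
theorem not_forall_weighted_jets_le_of_flatChart : ∀ (M a r₁ : ℝ), 0 < M → ∀ x₀ : Kerr.region a r₁, (x₀ : E4) 3 = 0 → ∀ (k : ℕ), 2 ≤ k → ∀ β : ℝ, ∃ δ : ℝ, 0 < δ ∧ ∀ (Ψ : (Kerr.regionBackground M a r₁).domain → Minkowski.spacetime.carrier) (L : Set (Kerr.regionBackground M a r₁).domain), IsOpen L → x₀ ∈ L → ContMDiffOn 𝓘(ℝ, E4) (𝓡 4) ∞ Ψ L → ¬ ∀ m ≤ k, ‖iteratedFDeriv ℝ m (Minkowski.spacetime.deviationExtend (Kerr.regionBackground M a r₁) Ψ) x₀‖ * Kerr.radius a x₀ ^ (β + (m : ℝ)) ≤ δ := by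
  intro M a r₁ hM x₀ hx3 k hk β
  obtain ⟨δ₀, hδ₀, H⟩ := exists_jet_gt_of_flatChart M a r₁ hM x₀ hx3
  have hr : 0 < Kerr.radius a x₀ := Kerr.radius_pos_of_mem_region x₀.2
  -- the smallest of the three weights `r^{β+m}`, `m ≤ 2`
  set w : ℝ := min (Kerr.radius a x₀ ^ (β + 0)) (min (Kerr.radius a x₀ ^ (β + 1)) (Kerr.radius a x₀ ^ (β + 2)))
    with hw
  have hwpos : 0 < w := lt_min (Real.rpow_pos_of_pos hr _)
    (lt_min (Real.rpow_pos_of_pos hr _) (Real.rpow_pos_of_pos hr _))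
  have hwle : ∀ m : ℕ, m ≤ 2 → w ≤ Kerr.radius a x₀ ^ (β + (m : ℝ)) := by
    intro m hm
    interval_cases m
    · exact (min_le_left _ _).trans (by norm_num)
    · exact (min_le_right _ _).trans ((min_le_left _ _).trans (by norm_num))
    · exact (min_le_right _ _).trans ((min_le_right _ _).trans (by norm_num))
  refine ⟨δ₀ * w, mul_pos hδ₀ hwpos, fun Ψ L hL hx₀L hΨ hall ↦ ?_⟩
  obtain ⟨m, hm, hgt⟩ := H Ψ L hL hx₀L hΨ
  have h := hall m (hm.trans hk)
  have hle : δ₀ * w < ‖iteratedFDeriv ℝ m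
      (Minkowski.spacetime.deviationExtend (Kerr.regionBackground M a r₁) Ψ) x₀‖ *
        Kerr.radius a x₀ ^ (β + (m : ℝ)) :=
    calc δ₀ * w ≤ δ₀ * Kerr.radius a x₀ ^ (β + (m : ℝ)) :=
          mul_le_mul_of_nonneg_left (hwle m hm) hδ₀.le
      _ < _ := mul_lt_mul_of_pos_right hgt (Real.rpow_pos_of_pos hr _)
  exact absurd (hle.trans_le h) (lt_irrefl _)

end Summit.FinalStateConjecture.FinalStateConjecture.Theorems.HullCurvature

end
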